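import Summits.CriticalPhenomena.PercolationContinuityZ3.Theorems.PercNearOneGluingNoHeavyQuantUniformSpread
import Summits.CriticalPhenomena.PercolationContinuityZ3.Theorems.PercNearOneGluingNoHeavyQuantReflectionGates
import HarnessLib

/-!
# QUANT lane R8, T-DEC: n EQUAL BLOBS ARE HEAVY AT THEIR AVERAGE GATE AS SOON AS THE UNIFORM-SPREADING LOAD IS `≤ 1` — conjecture BLOB-AFL
# for ANY width and gate vector reduced to ONE explicit inequality (prim-quant-census-2 gen 82, file 4)

builds on p205010 (kernel theorem, internal audit signed; external expert review pending)

Support file (`--supports stmt-CriticalPhenomena-4575`), QUANT lane census seat prim-quant-census-2 (gen 82); memo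
`run/shared/lean/prim/quant/prim-quant-census-2-g82/REFLECTION-G82.md` §3.  Theorems only, standard axioms, no sorries, no definitions.

For a gate list `G` (gates in `(0,1)`, `n = |G|`, `S = ΣG`) and a blob size `k ≥ 1` let `μ = blobLaw (G.map (k,·))` (top `M = n·k`), floor `x = S/n`,
target `T = k·S`.  The UNIFORM-SPREADING LOAD of `μ` is
  `L(G) = Σ_{l ≤ M, 2l < T} μ l / T_l`,  `T_l = Σ_{h ≤ M, h > T − l} μ h · (1 − γ_{lh})/γ_{lh}`,  `γ_{lh} = max(x, (T − 2l)/(h − l))`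
(only the multiples of `k` contribute).
* `pb_top_pos` — the top atom `μ (n·k) = Πgᵢ > 0`; hence every `T_l > 0` (`spreadCap_pos`: the top atom is admissible for every low atom).
* **`heavy_blobLaw_of_load_le_one`** — if `L(G) ≤ 1` then `μ` is heavy at `(S/n, k·S)` (`heavy_of_uniformSpread` with `c_l = μ l / T_l`);
  `decAtT_blobLaw_of_load_le_one`: DEC at every layer.
CONJECTURE C (memo §3; census there and in `…QuantUniformSpread`): `L(G) ≤ 1` for EVERY gate list — numerically 0 violations (sup ≈ 0.845 at
`n = 3`, `S ↓ 2`); with this file, C ⟹ conjecture BLOB-AFL (`…/prim-quant-census-2-g80/TRIPLE-G80.md` §5) at every width by one flow pattern.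
For `S ≤ 2` the load is the zero-only-low certificate (`heavy_of_zeroLow`), for `min gᵢ ≥ 1/2` BLOB-AFL is `heavy_blobLaw_gates_of_half_le`;
the middle band beyond width 4 is where C is needed.  C is NOT proved here.

HONEST STATUS.  Tool / reduction; `SiblingStep`, `FarTreeRow`, `GluedLemmaW`, `GluedDominatedMass` OPEN; RATE class (log\*) / honest sentence of
`run/shared/lean/prim/quant/README.md` unchanged.  [this work].  Nothing here is cited as a published result.  The gluing rows served
[cite: KozmaNitzan2024, Conjecture 3 (p. 15)]; product measure [cite: Grimmett1999, §1.3 p. 10].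
-/

noncomputable section

open scoped BigOperators

namespace Summit.CriticalPhenomena.PercolationContinuityZ3.Theorems
namespace Quant

open Finset

/-- the two-point law `{lo, hi; g}` (as in `…QuantLawDEC`) -/
local notation3 "TP[" lo ", " hi ", " g ", " h "]" =>
  (g : ℝ) * (if (h : ℕ) = (hi : ℕ) then (1 : ℝ) else 0) + (1 - (g : ℝ)) * (if (h : ℕ) = (lo : ℕ) then (1 : ℝ) else 0)

/-- the cheapest admissible gate of the pair `{l, h}` at floor `x`, target `T`: `max(x, (T − 2l)/(h − l))` -/
local notation3 "CG[" x ", " T ", " l ", " h "]" => max (x : ℝ) (((T : ℝ) - 2 * ((l : ℕ) : ℝ)) / (((h : ℕ) : ℝ) - ((l : ℕ) : ℝ)))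

/-- the Poisson-binomial point mass `P_G(j)`: the law of the blobs `(k, g)`, `g ∈ G`, at the atom `j·k` -/
local notation3 "PB[" k ", " G ", " j "]" => LawDec.blobLaw (List.map (fun g : ℝ => ((k : ℕ), g)) G) ((j : ℕ) * (k : ℕ))

namespace LawDec

/-- **the top atom of n blobs with positive gates is positive**: `P_G(n) > 0`. [this work] -/
theorem pb_top_pos (k : ℕ) (hk : 0 < k) : ∀ G : List ℝ, (∀ g ∈ G, 0 < g ∧ g < 1) → 0 < PB[k, G, G.length]
  | [], _ => by rw [List.length_nil, pb_nil_zero]; exact one_pos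
  | a :: G, hG => by
    have ha := hG a List.mem_cons_self
    have hG' : ∀ g ∈ G, 0 < g ∧ g < 1 := fun g hg => hG g (List.mem_cons_of_mem a hg)
    have hG0 : ∀ g ∈ G, 0 ≤ g ∧ g ≤ 1 := fun g hg => ⟨(hG' g hg).1.le, (hG' g hg).2.le⟩
    rw [List.length_cons, pb_cons_succ]
    have htop : PB[k, G, G.length + 1] = 0 :=
      blobLaw_eq_zero _ _ (by rw [blobTop_blobs]; exact Nat.mul_lt_mul_of_pos_right (Nat.lt_succ_self _) hk)
    rw [htop, mul_zero, zero_add]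
    exact mul_pos ha.1 (pb_top_pos k hk G hG')

/-- **every spreading capacity is positive**: for a low atom `l` (`2l < k·S`) the top atom `n·k` is admissible (`k·S − l < n·k`), has positive
mass and a gate `< 1`, so `T_l > 0`. [this work] -/
theorem spreadCap_pos (k : ℕ) (hk : 0 < k) (G : List ℝ) (hG : ∀ g ∈ G, 0 < g ∧ g < 1) (hn : 0 < G.length) (l : ℕ)
    (hl : 2 * (l : ℝ) < (k : ℝ) * G.sum) :
    0 < ∑ h ∈ Finset.range (G.length * k + 1),
      (if (k : ℝ) * G.sum - l < (h : ℝ) then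
        blobLaw (List.map (fun g : ℝ => (k, g)) G) h * (1 - CG[G.sum / G.length, (k : ℝ) * G.sum, l, h])
          / CG[G.sum / G.length, (k : ℝ) * G.sum, l, h] else 0) := by
  have hG0 : ∀ g ∈ G, 0 ≤ g ∧ g ≤ 1 := fun g hg => ⟨(hG g hg).1.le, (hG g hg).2.le⟩
  have hμ0 := blobLaw_nonneg _ (blobs_gates_mem k G hG0)
  have hn' : (0 : ℝ) < G.length := by exact_mod_cast hn
  have hk' : (0 : ℝ) < k := by exact_mod_cast hk
  have hSlt : G.sum < G.length := by
    obtain ⟨a, G', rfl⟩ := List.exists_cons_of_length_pos hn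
    rw [List.sum_cons, List.length_cons]
    push_cast
    have := sum_le_length G' fun g hg => (hG g (List.mem_cons_of_mem a hg)).2.le
    linarith [(hG a List.mem_cons_self).2]
  have hS0 : 0 ≤ G.sum := by
    exact List.sum_nonneg (fun g hg => (hG g hg).1.le)
  have hx1 : G.sum / G.length < 1 := (div_lt_one hn').2 hSlt
  have hx0 : 0 ≤ G.sum / G.length := div_nonneg hS0 hn'.le
  -- facts about the top pair `{l, n·k}`
  set M := G.length * k with hM
  have hMr : (M : ℝ) = (G.length : ℝ) * k := by rw [hM]; push_cast; ring
  have hTM : (k : ℝ) * G.sum - l < (M : ℝ) := by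
    rw [hMr]
    have : (k : ℝ) * G.sum < (G.length : ℝ) * k := by nlinarith
    have hl0 : (0 : ℝ) ≤ l := Nat.cast_nonneg l
    linarith
  have hd : 0 < (M : ℝ) - l := by
    have : 2 * (l : ℝ) < 2 * (M : ℝ) := by linarith
    linarith
  have hq1 : ((k : ℝ) * G.sum - 2 * (l : ℝ)) / ((M : ℝ) - l) < 1 := by rw [div_lt_one hd]; linarith
  have hq0 : 0 < ((k : ℝ) * G.sum - 2 * (l : ℝ)) / ((M : ℝ) - l) := div_pos (by linarith) hd
  have hγ1 : CG[G.sum / G.length, (k : ℝ) * G.sum, l, M] < 1 := max_lt hx1 hq1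
  have hγ0 : 0 < CG[G.sum / G.length, (k : ℝ) * G.sum, l, M] := lt_of_lt_of_le hq0 (le_max_right _ _)
  have htop : 0 < blobLaw (List.map (fun g : ℝ => (k, g)) G) M := by
    have := pb_top_pos k hk G hG; rwa [hM]
  -- the top term is positive, the others nonnegative
  have hmem : M ∈ Finset.range (M + 1) := Finset.mem_range.2 (Nat.lt_succ_self M)
  rw [← Finset.add_sum_erase _ _ hmem, if_pos hTM]
  refine add_pos_of_pos_of_nonneg (div_pos (mul_pos htop (by linarith)) hγ0) (Finset.sum_nonneg fun h hh => ?_)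
  split_ifs with hadm
  · have hh' : h < M := by
      have h1 := Finset.mem_range.1 (Finset.mem_of_mem_erase hh)
      have h2 := Finset.ne_of_mem_erase hh
      omega
    have hdh : 0 < (h : ℝ) - l := by
      have : (l : ℝ) < (k : ℝ) * G.sum - l := by linarith
      linarith
    have hqh0 : 0 < ((k : ℝ) * G.sum - 2 * (l : ℝ)) / ((h : ℝ) - l) := div_pos (by linarith) hdh
    have hqh1 : ((k : ℝ) * G.sum - 2 * (l : ℝ)) / ((h : ℝ) - l) ≤ 1 := by rw [div_le_one hdh]; linarith
    have hγh0 : 0 < CG[G.sum / G.length, (k : ℝ) * G.sum, l, h] := lt_of_lt_of_le hqh0 (le_max_right _ _)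
    have hγh1 : CG[G.sum / G.length, (k : ℝ) * G.sum, l, h] ≤ 1 := max_le hx1.le hqh1
    exact div_nonneg (mul_nonneg (hμ0 h) (by linarith)) hγh0.le
  · exact le_rfl

/-- **n EQUAL BLOBS ARE HEAVY AT THEIR AVERAGE GATE AS SOON AS THE UNIFORM-SPREADING LOAD IS `≤ 1`** (conjecture BLOB-AFL for the gate list
`G`, any width, reduced to one inequality; `heavy_of_uniformSpread` with `c_l = μ l / T_l`). [this work] -/
theorem heavy_blobLaw_of_load_le_one (k : ℕ) (hk : 0 < k) (G : List ℝ) (hG : ∀ g ∈ G, 0 < g ∧ g < 1) (hn : 0 < G.length)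
    (hload : ∑ l ∈ Finset.range (G.length * k + 1),
      (if 2 * (l : ℝ) < (k : ℝ) * G.sum then
        blobLaw (List.map (fun g : ℝ => (k, g)) G) l /
          ∑ h ∈ Finset.range (G.length * k + 1),
            (if (k : ℝ) * G.sum - l < (h : ℝ) then
              blobLaw (List.map (fun g : ℝ => (k, g)) G) h * (1 - CG[G.sum / G.length, (k : ℝ) * G.sum, l, h])
                / CG[G.sum / G.length, (k : ℝ) * G.sum, l, h] else 0)
        else 0) ≤ 1) :
    ∃ (ι : Type) (_ : Fintype ι) (lam γ : ι → ℝ) (lo hi : ι → ℕ),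
      (∀ i, 0 ≤ lam i) ∧ (∑ i, lam i = 1) ∧ (∀ i, 0 ≤ γ i ∧ γ i ≤ 1) ∧ (∀ i, lo i ≤ hi i) ∧ (∀ i, hi i ≤ G.length * k) ∧
      (∀ h, blobLaw (List.map (fun g : ℝ => (k, g)) G) h = ∑ i, lam i * TP[lo i, hi i, γ i, h]) ∧
      (∀ i, 0 < lam i → G.sum / G.length ≤ γ i ∧ (k : ℝ) * G.sum ≤ 2 * (lo i : ℝ) + ((hi i : ℝ) - lo i) * γ i) := by
  have hG0 : ∀ g ∈ G, 0 ≤ g ∧ g ≤ 1 := fun g hg => ⟨(hG g hg).1.le, (hG g hg).2.le⟩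
  have htop := blobTop_blobs k G
  have hμ0 := blobLaw_nonneg _ (blobs_gates_mem k G hG0)
  have hμM : ∀ h, G.length * k < h → blobLaw (List.map (fun g : ℝ => (k, g)) G) h = 0 :=
    fun h hh => blobLaw_eq_zero _ h (by rw [htop]; exact hh)
  have hμ1 : ∑ h ∈ Finset.range (G.length * k + 1), blobLaw (List.map (fun g : ℝ => (k, g)) G) h = 1 := by
    have h1 := sum_blobLaw (List.map (fun g : ℝ => (k, g)) G); rwa [htop] at h1
  have hn' : (0 : ℝ) < G.length := by exact_mod_cast hn
  have hS0 : 0 ≤ G.sum := List.sum_nonneg (fun g hg => (hG g hg).1.le)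
  have hx0 : 0 ≤ G.sum / G.length := div_nonneg hS0 hn'.le
  have hx1 : G.sum / G.length ≤ 1 :=
    (div_le_one hn').2 (sum_le_length G fun g hg => (hG g hg).2.le)
  -- the fractions `c_l = μ l / T_l` on the low atoms
  refine heavy_of_uniformSpread (G.sum / G.length) ((k : ℝ) * G.sum) (G.length * k) _
    (fun l => if 2 * (l : ℝ) < (k : ℝ) * G.sum then blobLaw (List.map (fun g : ℝ => (k, g)) G) l /
      ∑ h ∈ Finset.range (G.length * k + 1),
        (if (k : ℝ) * G.sum - l < (h : ℝ) then
          blobLaw (List.map (fun g : ℝ => (k, g)) G) h * (1 - CG[G.sum / G.length, (k : ℝ) * G.sum, l, h])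
            / CG[G.sum / G.length, (k : ℝ) * G.sum, l, h] else 0) else 0)
    hx0 hx1 hμ0 hμM hμ1 (fun l => ?_) ?_ (fun l _ hl => ?_)
  · -- `c_l ≥ 0`
    split_ifs with hl
    · exact div_nonneg (hμ0 l) (spreadCap_pos k hk G hG hn l hl).le
    · exact le_rfl
  · -- `Σ c_l ≤ 1` is the load hypothesis
    refine le_trans (le_of_eq (Finset.sum_congr rfl fun l _ => ?_)) hload
    split_ifs <;> rfl
  · -- exact service: `c_l · T_l = μ l`
    rw [if_pos hl]
    exact div_mul_cancel₀ _ (spreadCap_pos k hk G hG hn l hl).ne'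

/-- **hence DEC at every layer** under the load hypothesis. [this work] -/
theorem decAtT_blobLaw_of_load_le_one (k : ℕ) (hk : 0 < k) (G : List ℝ) (hG : ∀ g ∈ G, 0 < g ∧ g < 1) (hn : 0 < G.length)
    (hload : ∑ l ∈ Finset.range (G.length * k + 1),
      (if 2 * (l : ℝ) < (k : ℝ) * G.sum then
        blobLaw (List.map (fun g : ℝ => (k, g)) G) l /
          ∑ h ∈ Finset.range (G.length * k + 1),
            (if (k : ℝ) * G.sum - l < (h : ℝ) then
              blobLaw (List.map (fun g : ℝ => (k, g)) G) h * (1 - CG[G.sum / G.length, (k : ℝ) * G.sum, l, h])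
                / CG[G.sum / G.length, (k : ℝ) * G.sum, l, h] else 0)
        else 0) ≤ 1) (j : ℕ) :
    DECAtT (G.sum / G.length) ((k : ℝ) * G.sum) j (G.length * k) (blobLaw (List.map (fun g : ℝ => (k, g)) G)) :=
  decAtT_of_heavy _ _ _ _ (heavy_blobLaw_of_load_le_one k hk G hG hn hload) j

end LawDec
end Quant
end Summit.CriticalPhenomena.PercolationContinuityZ3.Theorems
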